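import Literature.MathematicalPhysics.QuantumFieldTheory.Balaban1983to89.B9Ineq346L2Final
import Literature.MathematicalPhysics.QuantumFieldTheory.Balaban1983to89.B9Thm34GpKernelUniform
import Literature.MathematicalPhysics.QuantumFieldTheory.Balaban1983to89.B9Thm34AllUniform

/-!
# `Balaban1983to89.B9Ineq346L2Uniform` — [Balaban1985BackgroundPropagators] THEOREM 3.4 p. 400 × THEOREM 3.1 (3.46) p. 398 / THEOREM 3.3 p. 399:
# THE `L²` MEMBERS (3.46)₁,₂,₃,₅ FOR BOTH EXTENDED OPERATORS `G′(U′U)` (3.64) AND `G(U′U)` (FILE 28/48), WITH THE CONSTANTS CHOSEN BEFORE THE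
# LATTICE: `∃ a₁ > 0 ∃ B ∀ (T_η, k, {Ω_j}, U, …) ∀ α₁ ≦ a₁ ∀ A …` — FILE 39 `thm34_Gp_l2_final` / `thm34_G_l2_final` re-quantified (FILE 58 of the
# Sect. B programme of cell `lit-balaban`, seat r06 gen 21; the first `L²` file of the uniformity series FILES 45–57)

statement-level skeleton of published theorems with citation tags; proofs where landed; nothing here is a claim about the Yang–Mills mass gap

CITATION HEADER (lean-in-tree rule).  B9 = T. Bałaban, *Propagators for lattice gauge theories in a background field*, Commun. Math. Phys.
**99** (1985) 389–434 [Balaban1985BackgroundPropagators] (held `paper:balaban1985-cmp99-background-propagators`; journal page = PDF page + 388):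
Theorem 3.4 p. 400 [PDF 12] L7–10 «There exists a positive constant a₁ such that the operators G′(U), (Q′(U)G′²(U)Q′*(U))⁻¹, R(U), G(U) extend
to configurations U′U for α₁ ≦ a₁ as analytic functions of A. The extended operators satisfy all the inequalities of Theorems 3.1–3.3
correspondingly»; Theorem 3.1 p. 397 [PDF 9] «There exist positive constants M₁, δ₀, a₀, B₀ dependent on d and L only»; (3.46) p. 398 [PDF 10]
«Finally, we have the inequalities in L²-norms ‖hG′(U)λ‖, ‖h∇_UG′(U)λ‖, ‖hG′(U)∇*_Uλ‖, ‖h∇_U∇_UG′(U)λ‖, ‖h∇_UG′(U)∇*_Uλ‖, ‖hG′(U)∇*_U∇*_Uλ‖ ≦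
B₀[(Lʲη)², Lʲη, Lʲη, 1, 1, 1]|h|e^{−δ₀d(y,y′)}‖λ‖ for supp h ⊂ Δ(y), y ∈ Λ_j, supp λ ⊂ Δ(y′)»; the remark after (3.47) p. 398 («Using Lemma 2.1 in
[4] we may replace the factor (Lʲη)^α by (Lʲη)^β(L^{j′}η)^γ with β + γ = α»); p. 399 L1–3 «Let us stress that the constants in the formulations of
both theorems do not depend on the sequence {Ω_j} …»; Theorem 3.3 p. 399 [PDF 11]; p. 403 [PDF 15] l. 2–5; p. 407; the kernel pairing p. 393
(`c = η^d`, block volume `(L^{j′}η)^d`).  [4] = [Balaban1984PropagatorsII] (2.64)–(2.66) p. 234, Lemma 2.1 p. 234 [PDF 12].  Rows B9.Thm3.4 ×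
B9.Thm3.1 ((3.46) cell) × B9.Thm3.3 (cells only; no row head changes).

WHY THIS FILE (B9-CLOSURE §3 item 4 / v3.3–v4.2: after FILES 45–57 every sup, kernel and Hölder member of the Sect. B programme has its uniform
twin; the `L²` members (3.46), FILES 39–41/44, kept the per-lattice shape `∀ (lattice …) ∃ a₁ ∃ B ∀ α₁ ∀ A`).  FILE 39 packages `a₁`, `B` after
the lattice; its proof reads `a₁` and the kernel constant `B′` from the per-lattice callees (FILES 29/28) and multiplies by the pairing-volume
constant `c_v` of `hvol` and the [4] Lemma 2.1 constant `Λ_v` of `hSTv` — the latter two taken from per-lattice data (`∃ Λ ≧ 1`, and the sign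
`0 ≦ c_v` derived from `hvol` at a site).  Here (as in FILES 45–57) both p. 398 / [4] Lemma 2.1 scale transfers are hypothesised in their
printed uniform form — functions `Λf`, `Λvf` of the exponent fixed BEFORE the lattice (`hST`, `hSTv` inside the `∀` read them) — the constant `c_v`
is an input fixed before the lattice together with its sign (`hcv`; print: `c_v = 1`, `c·#Δ(y′) = η^d(L^{j′})^d = v(y′)`, p. 393/p. 397), the
per-lattice callees are replaced by FILE 49 `thm34_Gp_kernel_uniform` / FILE 48 `thm34_all_uniform` invoked BEFORE the lattice, and the
quantifiers are re-ordered.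

WHAT IS PROVED (2 theorems: 0 `def`, 0 sorry, 0 new named facts; standard axioms).
* **`thm34_Gp_l2_uniform`** (§1) — FILE 39 `thm34_Gp_l2_final` verbatim in hypotheses (named binders inside the `∀`, less `hrepr` and `cv`; `hST`,
  `hSTv` in the uniform form) and conclusion (`G′(U′U)` = two-sided inverse of `Δ′_a(U) − V′(A)` ∧ the four `L²` members `‖hG′(U′U)λ‖₂ ≦
  BH(Lʲη)²e^{−(3δ₀/4)d(y,y′)}‖λ‖₂`, `‖h∇_kG′(U′U)λ‖₂, ‖hG′(U′U)∇_lλ‖₂ ≦ BH(Lʲη)e^{−(3δ₀/4)d}‖λ‖₂`, `‖h∇_kG′(U′U)∇_lλ‖₂ ≦ BHe^{−(3δ₀/4)d}‖λ‖₂`),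
  quantified `∃ a₁ > 0 ∃ B ≧ 0 ∀ (lattice, background, letters, Theorem 3.1 for G′(U) in kernel form, block volumes, v^{−1/2}-transfer) ∀ α₁ ≦ a₁
  ∀ A kF sF …`; `B = c_vΛ_v(1/20)B₄₉`.
* **`thm34_G_l2_uniform`** (§2) — FILE 39 `thm34_G_l2_final` likewise (hypotheses = FILE 48 `thm34_all_uniform`'s + `hvol`, `hSTv` inside the `∀`,
  `c_v`, `Λ_v(·)` with `hcv`, `hΛvf` before): `∃ a₁ > 0 ∃ B ≧ 0 ∀ (lattice …) ∀ α₁ ≦ a₁ ∀ A …` `∃ C⁻¹(U′U), G(U′U)` (FILE 28's pair, (ii)/(iii)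
  identities re-exported) with the same four members for `G(U′U)` at the rate `δ₀/20`; `B = c_vΛ_v(1/20)B₄₈`.
(FILE 39's per-lattice statements follow by instantiation with `Λf := fun _ => Λ`, `Λvf := fun _ => Λ_v` and the derived sign of `c_v`.)

PROOF.  FILE 39's proofs verbatim after the re-ordering (scripted: `work/unif.py` `make_uniform_file` with the `L²` hooks + `work/gen58.py`): the
uniform callee and the constant `c_vΛ_v(1/20)B′` BEFORE the lattice; inside, the callee's `∀`-clause applied to the lattice data, `hSTv (1/20)`, then
FILE 39 §1 `l2_block_of_kernelBound_transfer` BY NAME on each kernel entry.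

HONEST SCOPE / NOT CLAIMED.  As FILE 39 (module header (a)–(f) there: counting `ℓ²` norms of the real coordinates; (3.46)₄,₆ not covered here —
FILES 59–61; right differences are the letters `∇_l`).  NEW relative to FILE 39: `c_v` and `Λ_v(·)` are inputs fixed before the lattice (`hcv`,
`hΛvf`) instead of per-lattice data — the printed situation (`c_v = 1`; [4] Lemma 2.1's constant depends on `d`, `δ₀` and the exponent only).
The uniformity displayed is uniformity in `(S, T, 𝔅, blk)`, `U`, the operators, the letters, `v`, `c` AT FIXED input constants, `κ`, `(𝔸, b)`,
`Λ(·)`, `Λ_v(·)`, `c_v`.  NOT summit progress.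

RELATED IN THE TREE, NOT DUPLICATED (searched 2026-08-23: `lean search 'l2_uniform' --decl` = ∅): FILE 39 `B9Ineq346L2Final` (per-lattice; §1
devices USED BY NAME), FILE 49 `B9Thm34GpKernelUniform.thm34_Gp_kernel_uniform`, FILE 48 `B9Thm34AllUniform.thm34_all_uniform` — USED BY NAME; no
existing module modified.
-/

noncomputable section

namespace Literature.MathematicalPhysics.QuantumFieldTheory.Balaban1983to89.B9Ineq346L2Uniform

open NormedSpace Complex
open Literature.MathematicalPhysics.QuantumFieldTheory.Balaban1983to89
open Literature.MathematicalPhysics.QuantumFieldTheory.Balaban1983to89.B6RandomWalk (HasMajorant BlockSupp Triangle254 Ineq261)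
open Literature.MathematicalPhysics.QuantumFieldTheory.Balaban1983to89.B6RandomWalkHom (HasMajorantHom)
open Literature.MathematicalPhysics.QuantumFieldTheory.Balaban1983to89.B6RandomWalkKernel (ker apply_eq_sum_ker HasKernelBound hasKernelBound_mono)
open Literature.MathematicalPhysics.QuantumFieldTheory.Balaban1983to89.B6RandomWalkSection (secExt secRes secConj)
open Literature.MathematicalPhysics.QuantumFieldTheory.Balaban1983to89.B9Thm34Ext (toB6)
open Literature.MathematicalPhysics.QuantumFieldTheory.Balaban1983to89.B9Ineq347 (ScaleTransfer)
open Literature.MathematicalPhysics.QuantumFieldTheory.Balaban1983to89.B9Eq386Neumann (pTwo deltaA)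
open Literature.MathematicalPhysics.QuantumFieldTheory.Balaban1983to89.B9Eq39Adjoint
open Literature.MathematicalPhysics.QuantumFieldTheory.Balaban1983to89.B9Eq369Small (Through)
open Literature.MathematicalPhysics.QuantumFieldTheory.Balaban1983to89.B9Eq372Locality (stBonds)
open Literature.MathematicalPhysics.QuantumFieldTheory.Balaban1983to89.B9Eq352DivForm (tauF tauB)
open Literature.MathematicalPhysics.QuantumFieldTheory.Balaban1983to89.B9Eq352DivFormLetters
open Literature.MathematicalPhysics.QuantumFieldTheory.Balaban1983to89.B9Eq352GradLetters (diffLetter)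
open Literature.MathematicalPhysics.QuantumFieldTheory.Balaban1983to89.B9Eq371GradLetters (bT bU)
open Literature.MathematicalPhysics.QuantumFieldTheory.Balaban1983to89.B9Eq372RemLetters (lapDDLetter)
open Literature.MathematicalPhysics.QuantumFieldTheory.Balaban1983to89.B9Eq382V3Letters (dPrimeLetter)
open Literature.MathematicalPhysics.QuantumFieldTheory.Balaban1983to89.B9Eq376POneLetters (conjHom gradLin divLin)
open Literature.MathematicalPhysics.QuantumFieldTheory.Balaban1983to89.B9Eq360Vprime (gPrimeExtEnd)
open Literature.MathematicalPhysics.QuantumFieldTheory.Balaban1983to89.B9Eq360VprimeLetters (vPrimeConc)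
open Literature.MathematicalPhysics.QuantumFieldTheory.Balaban1983to89.B9Thm34GpKernelUniform (thm34_Gp_kernel_uniform)
open Literature.MathematicalPhysics.QuantumFieldTheory.Balaban1983to89.B9Thm34AllUniform (thm34_all_uniform)
open Literature.MathematicalPhysics.QuantumFieldTheory.Balaban1983to89.B9Ineq346L2Final (l2_block_of_kernelBound_transfer)

section L2U1

variable {𝔸 : Type*} [NormedRing 𝔸] [NormedAlgebra ℂ 𝔸] [CompleteSpace 𝔸] {ι : Type} [Fintype ι]
variable (b : Module.Basis ι ℝ 𝔸) (κ : Type) [Fintype κ]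

set_option maxHeartbeats 800000 in
/-- **THEOREM 3.4 × THEOREM 3.1: THE `L²` MEMBERS (3.46)₁,₂,₃,₅ FOR THE CONCRETE `G′(U′U) = G′(U)(I − V′(A)G′(U))⁻¹` OF (3.64), THE CONSTANTS
CHOSEN BEFORE THE LATTICE** («Finally, we have the inequalities in L²-norms ‖hG′(U)λ‖, ‖h∇_UG′(U)λ‖, ‖hG′(U)∇*_Uλ‖, … ≦ B₀[(Lʲη)², Lʲη, Lʲη,
1, …]|h|e^{−δ₀d(y,y′)}‖λ‖ for supp h ⊂ Δ(y), y ∈ Λ_j, supp λ ⊂ Δ(y′)» (3.46) p. 398; for `U′U` by Theorem 3.4 p. 400 and p. 403 l. 2–5; «the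
constants … do not depend on the sequence {Ω_j}», p. 399): `∃ a₁ > 0 ∃ B ≧ 0 ∀ (lattice 𝔅 = g, background U, data, Theorem 3.1 for G′(U) =
(Δ′_a(U))⁻¹ in kernel form, block volumes c·#Δ(y) ≦ c_v v(y), [4] Lemma 2.1 for v^{−1/2}) ∀ α₁ ≦ a₁ ∀ A kF sF …`: `G′(U′U) := gPrimeExtEnd G′(U)
(V′(A)G′(U))` is the two-sided inverse of `Δ′_a(U) − V′(A)` ∧ `∀ y y′ ∀ h` (`|h| ≦ H`, `supp h ⊂ Δ(y)`) `∀ λ` (`supp λ ⊂ Δ(y′)`): `‖hG′(U′U)λ‖₂ ≦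
BH(Lʲη)²e^{−(3δ₀/4)d(y,y′)}‖λ‖₂`, `‖h∇_kG′(U′U)λ‖₂ ≦ BH(Lʲη)e^{−(3δ₀/4)d}‖λ‖₂`, `‖hG′(U′U)∇_lλ‖₂ ≦ BH(Lʲη)e^{−(3δ₀/4)d}‖λ‖₂`, `‖h∇_kG′(U′U)∇_lλ‖₂
≦ BHe^{−(3δ₀/4)d}‖λ‖₂` (`k, l ∈ κ ⊕ κ`) — FILE 39 `thm34_Gp_l2_final` verbatim, re-quantified; the pairing-volume constant `c_v` (print: `1`) and
the `v^{−1/2}`-transfer constant `Λ_v(·)` are inputs fixed before the lattice (`hcv`, `hΛvf`); `B = c_vΛ_v(1/20)B₄₉`.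
[cite: Balaban1985BackgroundPropagators, Thm 3.4 p.400 + p.399 + Thm 3.1 (3.42)/(3.46) pp.397–398 + p.398 remark + p.393 + (3.64) p.402 + p.403 l.2–5; Balaban1984PropagatorsII, (2.64)–(2.66) p.234 + Lemma 2.1 p.234] -/
theorem thm34_Gp_l2_uniform [DecidableEq ι] (d : ℕ)
    (δ₀ BG Cq a₀ d₀ M₂ : ℝ) (Λf Λvf : ℝ → ℝ) (cv : ℝ)
    (hBG : 0 < BG) (hCq : 0 ≤ Cq) (ha₀ : 0 ≤ a₀) (hM₂ : 0 ≤ M₂) (hδ₀ : 0 < δ₀) (hΛf : ∀ α : ℝ, 0 < α → 1 ≤ Λf α)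
    -- NEW AT THE THEOREM LEVEL (L² files): [4] Lemma 2.1 for the block-volume weight `v^{−1/2}` read from `Λvf`, the sign of the pairing-volume constant
    (hΛvf : ∀ α : ℝ, 0 < α → 1 ≤ Λvf α) (hcv : 0 ≤ cv)
    (hrepr : ∀ (v : 𝔸) (i : ι), |b.repr v i| ≤ M₂ * ‖v‖) :
    ∃ a₁ : ℝ, 0 < a₁ ∧ ∃ B : ℝ, 0 ≤ B ∧
    ∀ {S : Type} [Fintype S] [DecidableEq S] (T : κ → Equiv.Perm S) (U : κ → S → 𝔸ˣ)
      {g : B9.Geometry} [Fintype g.Site] [DecidableEq g.Site] [Nonempty g.Site] {Rr : ℝ} {H : Prop} (blk : S → g.Site)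
      (kQ : g.Site → S → 𝔸 →L[ℝ] 𝔸) (sQ : S → 𝔸 →L[ℝ] 𝔸) (cfun w : g.Site → ℝ)
    -- the multiscale geometry 𝔅 (p. 393, [4] (2.1)–(2.4)) and its axioms
    (hdnn : ∀ a a' : g.Site, 0 ≤ g.dist a a') (htri : Triangle254 (toB6 g Rr H)) (hrefl : ∀ y : g.Site, g.dist y y = 0)
    (hsym : ∀ y y' : g.Site, g.dist y y' = g.dist y' y) (hlen : ∀ y : g.Site, 0 < g.len y) (hlenη : ∀ y : g.Site, g.eta ≤ g.len y)
    (hη : 0 < g.eta)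
    -- [4] Lemma 2.1 (2.61) at the rate `δ₀`, «for every 0 < α < 1», and the p. 398 scale transfer for every exponent
    (h261 : ∀ α : ℝ, 0 < α → α < 1 → Ineq261 d (toB6 g Rr H) δ₀ α)
      (hST : ∀ α : ℝ, 0 < α → ScaleTransfer g δ₀ α (Λf α) (fun a => g.len a) ∧ ScaleTransfer g δ₀ α (Λf α) (fun a => g.len a ^ 2) ∧
        ScaleTransfer g δ₀ α (Λf α) (fun a => (g.len a)⁻¹) ∧ ScaleTransfer g δ₀ α (Λf α) (fun a => (g.len a ^ 2)⁻¹) ∧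
        ScaleTransfer g δ₀ α (Λf α) (fun a => (g.len a ^ 4)⁻¹) ∧ ScaleTransfer g δ₀ α (Λf α) (fun y => g.len y ^ (-(4 : ℝ))))
    (hU1 : ∀ m z, ‖((U m z : 𝔸ˣ) : 𝔸)‖ ≤ 1 ∧ ‖(((U m z)⁻¹ : 𝔸ˣ) : 𝔸)‖ ≤ 1)
    (hd₀B : ∀ μ x, g.dist (blk x) (blk ((T μ).symm x)) ≤ d₀) (hd₀F : ∀ μ x, g.dist (blk x) (blk (T μ x)) ≤ d₀)
    (hd₀0 : ∀ y : g.Site, g.dist y y ≤ d₀)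
    -- the `A`-independent data of the concrete `V′(A)` of (3.60)
    (hw : ∀ y, 0 ≤ w y) (hcard : ∀ y, ((B9Eq360Vprime.block blk y).card : ℝ) * w y ≤ 1)
    (hkQ : ∀ y x, blk x = y → ‖kQ y x‖ ≤ w y) (hsQ : ∀ x, ‖sQ x‖ ≤ 1) (hcfun : ∀ y, |cfun y| ≤ a₀ * (g.len y ^ 2)⁻¹)
    -- THEOREM 3.1 for `G′(U)`: (3.24) `G′(U) = (Δ′_a(U))⁻¹` for the letter `Δ′_a(U)`, and (3.42)₁,₂,₃ at the rate `δ₀`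
    {Δp Gp : Module.End ℝ (S × ι → ℝ)} (hΔpGp : Δp * Gp = 1) (hGpΔp : Gp * Δp = 1)
    (h342_1 : HasMajorant (g := toB6 g Rr H) (fun p : S × ι => blk p.1) Gp
      (fun a a' => BG * g.len a ^ 2 * Real.exp (-(δ₀ * g.dist a a'))))
    (h342_2 : ∀ k : κ ⊕ κ, HasMajorant (g := toB6 g Rr H) (fun p : S × ι => blk p.1)
      (conj b (diffLetter T U ((g.eta : ℂ)⁻¹) k) * Gp) (fun a a' => BG * g.len a * Real.exp (-(δ₀ * g.dist a a'))))
    (h342_3 : ∀ k : κ ⊕ κ, HasMajorant (g := toB6 g Rr H) (fun p : S × ι => blk p.1)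
      (Gp * conj b (diffLetter T U ((g.eta : ℂ)⁻¹) k)) (fun a a' => BG * g.len a * Real.exp (-(δ₀ * g.dist a a'))))
    -- the kernel pairing of p. 393 (`c = η^d`, block volume weight `v(y′) = (L^{j′}η)^d`) and THEOREM 3.1's (3.42)₁₋₄ FOR `G′(U)` IN THE PRINTED KERNEL FORM
    {v : g.Site → ℝ} (hv : ∀ y, 0 < v y) {cK : ℝ} (hcK : 0 < cK)
    (hGpk : HasKernelBound (g := toB6 g Rr H) (fun p : S × ι => blk p.1) v cK Gp
      (fun a a' => BG * g.len a ^ 2 * Real.exp (-(δ₀ * g.dist a a'))))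
    (hDGpk : ∀ k : κ ⊕ κ, HasKernelBound (g := toB6 g Rr H) (fun p : S × ι => blk p.1) v cK
      (conj b (diffLetter T U ((g.eta : ℂ)⁻¹) k) * Gp) (fun a a' => BG * g.len a * Real.exp (-(δ₀ * g.dist a a'))))
    (hGpDk : ∀ l : κ ⊕ κ, HasKernelBound (g := toB6 g Rr H) (fun p : S × ι => blk p.1) v cK
      (Gp * conj b (diffLetter T U ((g.eta : ℂ)⁻¹) l)) (fun a a' => BG * g.len a * Real.exp (-(δ₀ * g.dist a a'))))
    (hDGpDk : ∀ k l : κ ⊕ κ, HasKernelBound (g := toB6 g Rr H) (fun p : S × ι => blk p.1) v cK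
      (conj b (diffLetter T U ((g.eta : ℂ)⁻¹) k) * Gp * conj b (diffLetter T U ((g.eta : ℂ)⁻¹) l)) (fun a a' => BG * Real.exp (-(δ₀ * g.dist a a'))))
    -- NEW: the block volumes in the kernel pairing (p. 393) and [4] Lemma 2.1 for the block-volume weight `v^{−1/2}` (p. 398 remark)
    (hvol : ∀ y : g.Site, cK * ((Finset.univ.filter (fun p : S × ι => blk p.1 = y)).card : ℝ) ≤ cv * v y)
    (hSTv : ∀ α : ℝ, 0 < α → ScaleTransfer g δ₀ α (Λvf α) (fun y => (Real.sqrt (v y))⁻¹)),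
    ∀ (α₁ : ℝ), 0 ≤ α₁ → α₁ ≤ a₁ →
    -- the exponent field `A` in the domain (3.37), read blockwise, and the `A`-dependent (3.59) data `kF`, `sF`
    ∀ (A : κ → S → 𝔸) (kF : g.Site → S → 𝔸 →L[ℝ] 𝔸) (sF : S → 𝔸 →L[ℝ] 𝔸),
      (∀ y x, blk x = y → ‖kF y x‖ ≤ Cq * α₁ * w y) → (∀ x, ‖sF x‖ ≤ Cq * α₁) →
      (∀ ν k x, ‖((g.eta : ℂ)⁻¹) • covDstar T U ν (A k) x‖ ≤ α₁ * (g.len (blk x) ^ 2)⁻¹) →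
      (∀ μ ν x, ‖((g.eta : ℂ)⁻¹) • covD T U μ (A ν) x‖ ≤ α₁ * (g.len (blk x) ^ 2)⁻¹) →
      (∀ μ x, ‖((g.eta : ℂ)⁻¹) • covDstar T U μ (tauB T U μ (A μ)) x‖ ≤ α₁ * (g.len (blk x) ^ 2)⁻¹) →
      (∀ k x, ‖A k x‖ ≤ α₁ * (g.len (blk x))⁻¹) → (∀ ν k x, ‖tauB T U ν (A k) x‖ ≤ α₁ * (g.len (blk x))⁻¹) →
      -- (i) `G′(U′U)` = the two-sided inverse of `Δ′_a(U) − V′(A)` (FILE 16/26, re-exported)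
      (Δp - (conj b (vPrimeConc T U g.eta A blk kQ kF sQ sF cfun))) * (gPrimeExtEnd Gp (conj b (vPrimeConc T U g.eta A blk kQ kF sQ sF cfun) * Gp)) = 1 ∧
      (gPrimeExtEnd Gp (conj b (vPrimeConc T U g.eta A blk kQ kF sQ sF cfun) * Gp)) * (Δp - (conj b (vPrimeConc T U g.eta A blk kQ kF sQ sF cfun))) = 1 ∧
      -- (vii′) NEW: the `L²` members (3.46)₁,₂,₃,₅ of Theorem 3.1 for `G′(U′U)`
      (∀ (y y' : g.Site) (hf μ : S × ι → ℝ) (Hh : ℝ), 0 ≤ Hh → (∀ x, |hf x| ≤ Hh) → (∀ x, blk x.1 ≠ y → hf x = 0) →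
        (∀ x, blk x.1 ≠ y' → μ x = 0) →
        Real.sqrt (∑ x, (hf x * (gPrimeExtEnd Gp (conj b (vPrimeConc T U g.eta A blk kQ kF sQ sF cfun) * Gp)) μ x) ^ 2) ≤ B * Hh * g.len y ^ 2 * Real.exp (-(3 / 4 * δ₀ * g.dist y y')) * Real.sqrt (∑ x, μ x ^ 2) ∧
        (∀ k : κ ⊕ κ, Real.sqrt (∑ x, (hf x * ((conj b (diffLetter T U ((g.eta : ℂ)⁻¹) k)) * (gPrimeExtEnd Gp (conj b (vPrimeConc T U g.eta A blk kQ kF sQ sF cfun) * Gp))) μ x) ^ 2) ≤ B * Hh * g.len y * Real.exp (-(3 / 4 * δ₀ * g.dist y y')) * Real.sqrt (∑ x, μ x ^ 2)) ∧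
        (∀ l : κ ⊕ κ, Real.sqrt (∑ x, (hf x * ((gPrimeExtEnd Gp (conj b (vPrimeConc T U g.eta A blk kQ kF sQ sF cfun) * Gp)) * (conj b (diffLetter T U ((g.eta : ℂ)⁻¹) l))) μ x) ^ 2) ≤ B * Hh * g.len y * Real.exp (-(3 / 4 * δ₀ * g.dist y y')) * Real.sqrt (∑ x, μ x ^ 2)) ∧
        (∀ k l : κ ⊕ κ, Real.sqrt (∑ x, (hf x * ((conj b (diffLetter T U ((g.eta : ℂ)⁻¹) k)) * (gPrimeExtEnd Gp (conj b (vPrimeConc T U g.eta A blk kQ kF sQ sF cfun) * Gp)) * (conj b (diffLetter T U ((g.eta : ℂ)⁻¹) l))) μ x) ^ 2) ≤ B * Hh * Real.exp (-(3 / 4 * δ₀ * g.dist y y')) * Real.sqrt (∑ x, μ x ^ 2))) := by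
  classical
  -- the scale-transfer constants of the chain, READ FROM THE GIVEN FUNCTION `Λvf` (lattice-free)
  have hΛ1 : 1 ≤ Λvf (1 / 20) := hΛvf _ (by norm_num)
  obtain ⟨a₁, ha₁, B', hB', H16⟩ := thm34_Gp_kernel_uniform b κ d δ₀ BG Cq a₀ d₀ M₂ Λf hBG hCq ha₀ hM₂ hδ₀ hΛf hrepr
  refine ⟨a₁, ha₁, cv * (Λvf (1 / 20)) * B', mul_nonneg (mul_nonneg hcv (zero_le_one.trans hΛ1)) hB', ?_⟩
  -- NOW the lattice, the background, the data, the Theorems-for-`U` inputs (block and kernel members); then `α₁`, `A` and the `A`-letters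
  intro S _ _ T U g _ _ _ Rr H blk kQ sQ cfun w hdnn htri hrefl hsym hlen hlenη hη h261 hST hU1 hd₀B hd₀F hd₀0 hw hcard hkQ hsQ hcfun Δp Gp hΔpGp
    hGpΔp h342_1 h342_2 h342_3 v hv cK hcK hGpk hDGpk hGpDk hDGpDk hvol hSTv α₁ hα₁0 hα₁1 A kF sF hkF hsF h337B h337F h337Bτ hA hAτB
  replace H16 := H16 T U blk kQ sQ cfun w hdnn htri hrefl hsym hlen hlenη hη h261 hST hU1 hd₀B hd₀F hd₀0 hw hcard hkQ hsQ hcfun hΔpGp hGpΔp h342_1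
    h342_2 h342_3 hv hcK hGpk hDGpk hGpDk hDGpDk
  have hTv := hSTv (1 / 20) (by norm_num)
  obtain ⟨e1, e2, K1, K2, K3, K4⟩ := H16 α₁ hα₁0 hα₁1 A kF sF hkF hsF h337B h337F h337Bτ hA hAτB
  have hρ' : 3 / 4 * δ₀ + 1 / 20 * δ₀ ≤ 4 / 5 * δ₀ := by linarith only [hδ₀]
  have hw2 : ∀ a : g.Site, 0 ≤ g.len a ^ 2 := fun a => sq_nonneg _
  have hw1 : ∀ a : g.Site, 0 ≤ g.len a := fun a => (hlen a).le
  have hw0 : ∀ _a : g.Site, (0 : ℝ) ≤ 1 := fun _ => zero_le_one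
  refine ⟨e1, e2, ?_⟩
  intro y y' hf μ Hh hHh hh hh0 hμ0
  refine ⟨?_, ?_, ?_, ?_⟩
  · simpa only using l2_block_of_kernelBound_transfer (R := Rr) (H := H) (fun p : S × ι => blk p.1) hv hcK hvol hB' hρ' hdnn hTv
      (w := fun a => g.len a ^ 2) hw2 K1 y y' hf μ Hh hHh hh hh0 hμ0
  · intro k
    simpa only using l2_block_of_kernelBound_transfer (R := Rr) (H := H) (fun p : S × ι => blk p.1) hv hcK hvol hB' hρ' hdnn hTv
      (w := fun a => g.len a) hw1 (K2 k) y y' hf μ Hh hHh hh hh0 hμ0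
  · intro l
    simpa only using l2_block_of_kernelBound_transfer (R := Rr) (H := H) (fun p : S × ι => blk p.1) hv hcK hvol hB' hρ' hdnn hTv
      (w := fun a => g.len a) hw1 (K3 l) y y' hf μ Hh hHh hh hh0 hμ0
  · intro k l
    have K4' := hasKernelBound_mono (g := toB6 g Rr H) (fun p : S × ι => blk p.1) hv (K4 k l)
      (K' := fun a a' => B' * (1 : ℝ) * Real.exp (-(4 / 5 * δ₀ * g.dist a a'))) fun a a' => le_of_eq (by ring)
    simpa only [mul_one] using l2_block_of_kernelBound_transfer (R := Rr) (H := H) (fun p : S × ι => blk p.1) hv hcK hvol hB' hρ' hdnn hTv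
      (w := fun _ => (1 : ℝ)) hw0 K4' y y' hf μ Hh hHh hh hh0 hμ0

end L2U1

section L2U2

variable {𝔸 : Type*} [NormedRing 𝔸] [NormedAlgebra ℂ 𝔸] [CompleteSpace 𝔸] {ι : Type} [Fintype ι]
variable (b : Module.Basis ι ℝ 𝔸) (κ : Type) [Fintype κ] [LinearOrder κ]

set_option maxHeartbeats 1600000 in
/-- **THEOREM 3.4 × THEOREM 3.3: THE `L²` MEMBERS (3.46)₁,₂,₃,₅ FOR THE `G(U′U)` OF FILE 28/48, THE CONSTANTS CHOSEN BEFORE THE LATTICE**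
(Theorem 3.3 p. 399 «with G′(U) replaced by G(U) and λ replaced by a function J defined at bonds»; (3.46) p. 398; for `U′U` by Theorem 3.4
p. 400 and p. 407; «the constants … do not depend on the sequence {Ω_j}», p. 399): `∃ a₁ > 0 ∃ B ≧ 0 ∀ (lattice 𝔅 = g, background U, data,
Theorems 3.1–3.3 for U as FILE 28/48, block volumes of the bond carrier, [4] Lemma 2.1 for v^{−1/2}) ∀ α₁ ≦ a₁ ∀ A …` (FILE 28's premises
verbatim) `∃ C⁻¹(U′U), G(U′U)` — FILE 28's pair ((ii)/(iii) defining identities re-exported) — with, for all `y, y′`, `h` (`|h| ≦ H`, `supp h ⊂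
Δ(y)`), `J` (`supp J ⊂ Δ(y′)`): `‖hG(U′U)J‖₂ ≦ BH(Lʲη)²e^{−(δ₀/20)d(y,y′)}‖J‖₂`, `‖h∇_kG(U′U)J‖₂, ‖hG(U′U)∇_lJ‖₂ ≦ BH(Lʲη)e^{−(δ₀/20)d}‖J‖₂`,
`‖h∇_kG(U′U)∇_lJ‖₂ ≦ BHe^{−(δ₀/20)d}‖J‖₂` — FILE 39 `thm34_G_l2_final` verbatim, re-quantified; `c_v`, `Λ_v(·)` inputs fixed before the lattice
(`hcv`, `hΛvf`); `B = c_vΛ_v(1/20)B₄₈`.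
[cite: Balaban1985BackgroundPropagators, Thm 3.4 p.400 + p.399 + Thm 3.3 p.399 + Thm 3.1 (3.42)/(3.46) pp.397–398 + p.398 remark + p.393 + (3.84)–(3.86) p.407; Balaban1984PropagatorsII, (2.64)–(2.66) p.234 + Lemma 2.1 p.234] -/
theorem thm34_G_l2_uniform [DecidableEq ι] (d : ℕ)
    (δ₀ B₀ κQ BG B₁ cF Cq a₀ C₀ d₀ M₂ κQb cFb abar : ℝ) (Λf Λvf : ℝ → ℝ) (cv : ℝ)
    (hB₀ : 0 ≤ B₀) (hκQ : 0 < κQ) (hBG : 0 < BG) (hB₁ : 0 < B₁) (hcF : 0 < cF) (hCq : 0 ≤ Cq) (ha₀ : 0 ≤ a₀) (hC₀ : 0 ≤ C₀)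
    (hM₂ : 0 ≤ M₂) (hδ₀ : 0 < δ₀) (hκQb : 0 ≤ κQb) (hcFb : 0 ≤ cFb) (habar : 0 ≤ abar) (hΛf : ∀ α : ℝ, 0 < α → 1 ≤ Λf α)
    -- NEW AT THE THEOREM LEVEL (L² files): [4] Lemma 2.1 for the block-volume weight `v^{−1/2}` read from `Λvf`, the sign of the pairing-volume constant
    (hΛvf : ∀ α : ℝ, 0 < α → 1 ≤ Λvf α) (hcv : 0 ≤ cv)
    (hrepr : ∀ (v : 𝔸) (i : ι), |b.repr v i| ≤ M₂ * ‖v‖) :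
    ∃ a₁ : ℝ, 0 < a₁ ∧ ∃ B : ℝ, 0 ≤ B ∧
    ∀ {S : Type} [Fintype S] [DecidableEq S] (T : κ → Equiv.Perm S) (U : κ → S → 𝔸ˣ)
      {g : B9.Geometry} [Fintype g.Site] [DecidableEq g.Site] [Nonempty g.Site] {Rr : ℝ} {H : Prop} (blk : S → g.Site)
      (kQ : g.Site → S → 𝔸 →L[ℝ] 𝔸) (sQ : S → 𝔸 →L[ℝ] 𝔸) (cfun w : g.Site → ℝ)
    -- the multiscale geometry 𝔅 (p. 393, [4] (2.1)–(2.4)) and its axioms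
    (hdnn : ∀ a a' : g.Site, 0 ≤ g.dist a a') (htri : Triangle254 (toB6 g Rr H)) (hrefl : ∀ y : g.Site, g.dist y y = 0)
    (hsym : ∀ y y' : g.Site, g.dist y y' = g.dist y' y) (hlen : ∀ y : g.Site, 0 < g.len y) (hlenη : ∀ y : g.Site, g.eta ≤ g.len y)
    (hη : 0 < g.eta) (hL : 1 ≤ g.L)
    -- [4] Lemma 2.1 (2.61) at the rate `δ₀`, «for every 0 < α < 1»
    (h261 : ∀ α : ℝ, 0 < α → α < 1 → Ineq261 d (toB6 g Rr H) δ₀ α)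
    -- p. 398: «Using Lemma 2.1 in [4] we may replace the factor (Lʲη)^α by (Lʲη)^β(L^{j′}η)^γ with β + γ = α» — for every exponent, one
    -- constant `Λ(α) ≧ 1` for the six weights `(Lʲη)^{1,2,−1,−2,−4}` (natural and real powers)
      (hST : ∀ α : ℝ, 0 < α → ScaleTransfer g δ₀ α (Λf α) (fun a => g.len a) ∧ ScaleTransfer g δ₀ α (Λf α) (fun a => g.len a ^ 2) ∧
        ScaleTransfer g δ₀ α (Λf α) (fun a => (g.len a)⁻¹) ∧ ScaleTransfer g δ₀ α (Λf α) (fun a => (g.len a ^ 2)⁻¹) ∧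
        ScaleTransfer g δ₀ α (Λf α) (fun a => (g.len a ^ 4)⁻¹) ∧ ScaleTransfer g δ₀ α (Λf α) (fun y => g.len y ^ (-(4 : ℝ))))
    -- real coordinates of `𝔸`, commuting translations, unitary-type background
    (hT : ∀ (μ ν : κ) (x : S), T μ (T ν x) = T ν (T μ x))
    (hU1 : ∀ m z, ‖((U m z : 𝔸ˣ) : 𝔸)‖ ≤ 1 ∧ ‖(((U m z)⁻¹ : 𝔸ˣ) : 𝔸)‖ ≤ 1)
    -- (3.35) on the plaquettes through each bond, at that bond's block scale; stencil geometry at range `d₀`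
    (h35 : ∀ μ x m n y, Through T μ x m n y → ‖(plaqU T U m n y : 𝔸) - 1‖ ≤ C₀ * ((g.L ^ g.scale (blk x))⁻¹) ^ 2)
    (hd₀B : ∀ μ x, g.dist (blk x) (blk ((T μ).symm x)) ≤ d₀) (hd₀F : ∀ μ x, g.dist (blk x) (blk (T μ x)) ≤ d₀)
    (hd₀FB : ∀ μ ν x, g.dist (blk x) (blk ((T ν).symm (T μ x))) ≤ d₀)
    (hd₀st : ∀ μ x (q : κ × S), q ∈ stBonds T μ x → g.dist (blk x) (blk q.2) ≤ d₀)
    (hd₀loc : ∀ μ x (q : κ × S), q ∈ B9Eq375Locality.locBondsA' T μ x → g.dist (blk x) (blk q.2) ≤ d₀)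
    (hd₀0 : ∀ y : g.Site, g.dist y y ≤ d₀)
    -- the `A`-independent data of the concrete `V′(A)` of (3.60): (3.19) kernels/multipliers and the `a`-weights of (3.24)
    (hw : ∀ y, 0 ≤ w y) (hcard : ∀ y, ((B9Eq360Vprime.block blk y).card : ℝ) * w y ≤ 1)
    (hkQ : ∀ y x, blk x = y → ‖kQ y x‖ ≤ w y) (hsQ : ∀ x, ‖sQ x‖ ≤ 1) (hcfun : ∀ y, |cfun y| ≤ a₀ * (g.len y ^ 2)⁻¹)
    -- THEOREM 3.1 for `G′(U)`: (3.42)₁,₂,₃ at the rate `δ₀`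
    {Gp : Module.End ℝ (S × ι → ℝ)}
    (h342_1 : HasMajorant (g := toB6 g Rr H) (fun p : S × ι => blk p.1) Gp
      (fun a a' => BG * g.len a ^ 2 * Real.exp (-(δ₀ * g.dist a a'))))
    (h342_2 : ∀ k : κ ⊕ κ, HasMajorant (g := toB6 g Rr H) (fun p : S × ι => blk p.1)
      (conj b (diffLetter T U ((g.eta : ℂ)⁻¹) k) * Gp) (fun a a' => BG * g.len a * Real.exp (-(δ₀ * g.dist a a'))))
    (h342_3 : ∀ k : κ ⊕ κ, HasMajorant (g := toB6 g Rr H) (fun p : S × ι => blk p.1)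
      (Gp * conj b (diffLetter T U ((g.eta : ℂ)⁻¹) k)) (fun a a' => BG * g.len a * Real.exp (-(δ₀ * g.dist a a'))))
    -- (3.24): `G′(U) = (Δ′_a(U))⁻¹` for the letter `Δ′_a(U)`
    {Δp : Module.End ℝ (S × ι → ℝ)} (hΔpGp : Δp * Gp = 1) (hGpΔp : Gp * Δp = 1)
    -- the (3.19) letters `Q′(U)`, `Q′*(U)` in their own typing with block-local two-space majorants, a section of the block map (FILE 17)
    (rep : g.Site → S × ι) (hrep : ∀ y : g.Site, blk (rep y).1 = y)
    {Qc : (S × ι → ℝ) →ₗ[ℝ] (g.Site → ℝ)} {Qcs : (g.Site → ℝ) →ₗ[ℝ] (S × ι → ℝ)} {Linv : Module.End ℝ (g.Site → ℝ)}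
    (hQc : HasMajorantHom (g := toB6 g Rr H) (fun p : S × ι => blk p.1) (fun y : g.Site => y) Qc
      (fun a a' : g.Site => κQ * (if a = a' then (1 : ℝ) else 0)))
    (hQcs : HasMajorantHom (g := toB6 g Rr H) (fun y : g.Site => y) (fun p : S × ι => blk p.1) Qcs
      (fun a a' : g.Site => κQ * (if a = a' then (1 : ℝ) else 0)))
    -- THEOREM 3.2 for `U`: (3.21) `C⁻¹ = (Q′G′²Q′*)⁻¹` exists (`hLinv`) with the KERNEL bound (3.48) at the rate `δ₀`
    (hLinv : (Qc ∘ₗ (Gp * Gp) ∘ₗ Qcs) * Linv = 1)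
    (h348 : ∀ y y' : g.Site, |B9Thm34Inv.ker (B9Thm34Inv.vol g d) Linv y y'| ≤
      B₁ * g.len y ^ (-(4 : ℝ)) * g.len y' ^ (-(d : ℝ)) * Real.exp (-(δ₀ * g.dist y y')))
    -- the (3.15) bond letters `Q(U)`, `Q*(U)` and the weight letter `a` of (3.24)/(3.26), with their majorants
    {G Qs Q a : Module.End ℝ ((κ × S) × ι → ℝ)}
    (hQb : HasMajorant (g := toB6 g Rr H) (fun q : (κ × S) × ι => blk q.1.2) Q (fun a a' => κQb * Real.exp (-(δ₀ * g.dist a a'))))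
    (hQsb : HasMajorant (g := toB6 g Rr H) (fun q : (κ × S) × ι => blk q.1.2) Qs (fun a a' => κQb * Real.exp (-(δ₀ * g.dist a a'))))
    (ha324 : HasMajorant (g := toB6 g Rr H) (fun q : (κ × S) × ι => blk q.1.2) a
      (fun a a' : g.Site => if a = a' then abar * (g.len a ^ 2)⁻¹ else 0))
    -- THEOREM 3.3 for `G(U)`: two-sided inverse of the concrete `Δ_a(U)` and its (3.42)-entries at the rate `δ₀`
    (hΔG : deltaA (conj b (lapDDLetter T ((g.eta : ℂ)⁻¹) U)) (conj b (dPrimeLetter T U g.eta))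
      (conjHom b (gradLin T ((g.eta : ℂ)⁻¹) U) ∘ₗ (1 - (Gp ∘ₗ Qcs ∘ₗ Linv ∘ₗ Qc ∘ₗ Gp)) ∘ₗ conjHom b (divLin T ((g.eta : ℂ)⁻¹) U)) Qs a Q * G = 1)
    (hGΔ : G * deltaA (conj b (lapDDLetter T ((g.eta : ℂ)⁻¹) U)) (conj b (dPrimeLetter T U g.eta))
      (conjHom b (gradLin T ((g.eta : ℂ)⁻¹) U) ∘ₗ (1 - (Gp ∘ₗ Qcs ∘ₗ Linv ∘ₗ Qc ∘ₗ Gp)) ∘ₗ conjHom b (divLin T ((g.eta : ℂ)⁻¹) U)) Qs a Q = 1)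
    (hG : HasMajorant (g := toB6 g Rr H) (fun q : (κ × S) × ι => blk q.1.2) G
      (fun a a' => B₀ * g.len a ^ 2 * Real.exp (-(δ₀ * g.dist a a'))))
    (hDG : ∀ k : κ ⊕ κ, HasMajorant (g := toB6 g Rr H) (fun q : (κ × S) × ι => blk q.1.2)
      (conj b (diffLetter (bT T) (bU U) ((g.eta : ℂ)⁻¹) k) * G) (fun a a' => B₀ * g.len a * Real.exp (-(δ₀ * g.dist a a'))))
    (hGD : ∀ k : κ ⊕ κ, HasMajorant (g := toB6 g Rr H) (fun q : (κ × S) × ι => blk q.1.2)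
      (G * conj b (diffLetter (bT T) (bU U) ((g.eta : ℂ)⁻¹) k)) (fun a a' => B₀ * g.len a * Real.exp (-(δ₀ * g.dist a a'))))
    -- (kernel form): Theorem 3.3's (3.42)₁,₂,₃,₄ for `G(U)` as PRINTED KERNEL BOUNDS (pairing weight `c = η^d`, volume weight `v(y′) = (L^j′ η)^d`)
    {v : g.Site → ℝ} (hv : ∀ y, 0 < v y) {c : ℝ} (hc : 0 < c)
    (hGk : HasKernelBound (g := toB6 g Rr H) (fun q : (κ × S) × ι => blk q.1.2) v c G
      (fun a a' => B₀ * g.len a ^ 2 * Real.exp (-(δ₀ * g.dist a a'))))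
    (hDGk : ∀ k : κ ⊕ κ, HasKernelBound (g := toB6 g Rr H) (fun q : (κ × S) × ι => blk q.1.2) v c
      (conj b (diffLetter (bT T) (bU U) ((g.eta : ℂ)⁻¹) k) * G) (fun a a' => B₀ * g.len a * Real.exp (-(δ₀ * g.dist a a'))))
    (hGDk : ∀ l : κ ⊕ κ, HasKernelBound (g := toB6 g Rr H) (fun q : (κ × S) × ι => blk q.1.2) v c
      (G * conj b (diffLetter (bT T) (bU U) ((g.eta : ℂ)⁻¹) l)) (fun a a' => B₀ * g.len a * Real.exp (-(δ₀ * g.dist a a'))))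
    (hDGDk : ∀ k l : κ ⊕ κ, HasKernelBound (g := toB6 g Rr H) (fun q : (κ × S) × ι => blk q.1.2) v c
      (conj b (diffLetter (bT T) (bU U) ((g.eta : ℂ)⁻¹) k) * G * conj b (diffLetter (bT T) (bU U) ((g.eta : ℂ)⁻¹) l)) (fun a a' => B₀ * Real.exp (-(δ₀ * g.dist a a'))))
    -- NEW: the block volumes of the bond carrier in the kernel pairing (p. 393) and [4] Lemma 2.1 for the block-volume weight `v^{−1/2}` (p. 398 remark)
    (hvol : ∀ y : g.Site, c * ((Finset.univ.filter (fun q : (κ × S) × ι => blk q.1.2 = y)).card : ℝ) ≤ cv * v y)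
    (hSTv : ∀ α : ℝ, 0 < α → ScaleTransfer g δ₀ α (Λvf α) (fun y => (Real.sqrt (v y))⁻¹)),
    ∀ (α₁ : ℝ), 0 ≤ α₁ → α₁ ≤ a₁ →
    -- the exponent field `A` in the domain (3.37), read blockwise in the shapes of FILES 1–19, and the `A`-dependent (3.59) data `kF`, `sF`
    ∀ (A : κ → S → 𝔸) (kF : g.Site → S → 𝔸 →L[ℝ] 𝔸) (sF : S → 𝔸 →L[ℝ] 𝔸),
      (∀ y x, blk x = y → ‖kF y x‖ ≤ Cq * α₁ * w y) → (∀ x, ‖sF x‖ ≤ Cq * α₁) →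
      (∀ ν k x, ‖((g.eta : ℂ)⁻¹) • covDstar T U ν (A k) x‖ ≤ α₁ * (g.len (blk x) ^ 2)⁻¹) →
      (∀ μ ν x, ‖((g.eta : ℂ)⁻¹) • covD T U μ (A ν) x‖ ≤ α₁ * (g.len (blk x) ^ 2)⁻¹) →
      (∀ μ ν x, ‖((g.eta : ℂ)⁻¹) • covDstar T U ν (A ν) (T μ x)‖ ≤ α₁ * (g.len (blk x) ^ 2)⁻¹) →
      (∀ μ x, ‖((g.eta : ℂ)⁻¹) • covDstar T U μ (tauB T U μ (A μ)) x‖ ≤ α₁ * (g.len (blk x) ^ 2)⁻¹) →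
      (∀ μ ν k x, ‖((g.eta : ℂ)⁻¹) • covD T U μ (A k) ((T ν).symm x)‖ ≤ α₁ * (g.len (blk x) ^ 2)⁻¹) →
      (∀ k x, ‖A k x‖ ≤ α₁ * (g.len (blk x))⁻¹) → (∀ ν k x, ‖tauB T U ν (A k) x‖ ≤ α₁ * (g.len (blk x))⁻¹) →
      (∀ μ k x, ‖tauF T U μ (A k) x‖ ≤ α₁ * (g.len (blk x))⁻¹) →
      (∀ k μ ν x, ‖A k ((T ν).symm (T μ x))‖ ≤ α₁ * (g.len (blk x))⁻¹) →
      (∀ μ x m z, (m, z) ∈ stBonds T μ x → ‖A m z‖ ≤ α₁ * (g.len (blk x))⁻¹) →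
      (∀ μ x m z, (m, z) ∈ B9Eq375Locality.locBondsA T μ x → ‖A m z‖ ≤ α₁ * (g.len (blk x))⁻¹) →
      (∀ μ x m n y, Through T μ x m n y →
        ‖covD T U m (A n) y‖ ≤ g.eta * (α₁ * ((g.len (blk x))⁻¹) ^ 2) ∧ ‖covD T U n (A m) y‖ ≤ g.eta * (α₁ * ((g.len (blk x))⁻¹) ^ 2)) →
    -- the (3.57)/(3.59) letters `F′₂(A)`, `F′₂*(A)` (block-local, size `c_F α₁`)
    ∀ {Qc' Fc : (S × ι → ℝ) →ₗ[ℝ] (g.Site → ℝ)} {Qcs' Fcs : (g.Site → ℝ) →ₗ[ℝ] (S × ι → ℝ)},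
      Qc' = Qc + Fc → Qcs' = Qcs + Fcs →
      HasMajorantHom (g := toB6 g Rr H) (fun p : S × ι => blk p.1) (fun y : g.Site => y) Fc
        (fun a a' : g.Site => cF * α₁ * (if a = a' then (1 : ℝ) else 0)) →
      HasMajorantHom (g := toB6 g Rr H) (fun y : g.Site => y) (fun p : S × ι => blk p.1) Fcs
        (fun a a' : g.Site => cF * α₁ * (if a = a' then (1 : ℝ) else 0)) →
    -- the (3.80)–(3.81) letters `F₂(A)`, `F₂*(A)` («|F₂(A)|, |F₂*(A)| ≦ O(1)α₁»), `P₂(A)` of (3.82)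
    ∀ {P₂ Qs' Q' F₂ F₂s : Module.End ℝ ((κ × S) × ι → ℝ)},
      Q' = Q + F₂ → Qs' = Qs + F₂s → P₂ = pTwo Qs Q F₂ F₂s a →
      HasMajorant (g := toB6 g Rr H) (fun q : (κ × S) × ι => blk q.1.2) F₂ (fun a a' => cFb * α₁ * Real.exp (-(δ₀ * g.dist a a'))) →
      HasMajorant (g := toB6 g Rr H) (fun q : (κ × S) × ι => blk q.1.2) F₂s (fun a a' => cFb * α₁ * Real.exp (-(δ₀ * g.dist a a'))) →
    ∃ (Tinv : Module.End ℝ (g.Site → ℝ)) (GExt : Module.End ℝ ((κ × S) × ι → ℝ)),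
      -- (ii) `C⁻¹(U′U)` = THE two-sided inverse of `Q′(U′U)G′²(U′U)Q′*(U′U)` (FILE 28, re-exported)
      Tinv * (Qc' ∘ₗ ((gPrimeExtEnd Gp (conj b (vPrimeConc T U g.eta A blk kQ kF sQ sF cfun) * Gp)) * (gPrimeExtEnd Gp (conj b (vPrimeConc T U g.eta A blk kQ kF sQ sF cfun) * Gp))) ∘ₗ Qcs') = 1 ∧
      (Qc' ∘ₗ ((gPrimeExtEnd Gp (conj b (vPrimeConc T U g.eta A blk kQ kF sQ sF cfun) * Gp)) * (gPrimeExtEnd Gp (conj b (vPrimeConc T U g.eta A blk kQ kF sQ sF cfun) * Gp))) ∘ₗ Qcs') * Tinv = 1 ∧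
      -- (iii) `G(U′U)` = THE two-sided inverse of the concrete `Δ_a(U′U)` built with this `C⁻¹(U′U)` (FILE 28, re-exported)
      deltaA (conj b (lapDDLetter T ((g.eta : ℂ)⁻¹) (prodCfg U g.eta A)))
          (conj b (dPrimeLetter T (prodCfg U g.eta A) g.eta))
          (conjHom b (gradLin T ((g.eta : ℂ)⁻¹) (prodCfg U g.eta A)) ∘ₗ (1 - ((Gp ∘ₗ Qcs ∘ₗ Linv ∘ₗ Qc ∘ₗ Gp) + (B9Eq360Vprime.pPrime Gp (gPrimeExtEnd Gp (conj b (vPrimeConc T U g.eta A blk kQ kF sQ sF cfun) * Gp)) (Qcs ∘ₗ secRes rep) (Qcs' ∘ₗ secRes rep) (secConj rep Linv) (secConj rep Tinv) (secExt rep ∘ₗ Qc) (secExt rep ∘ₗ Qc'))))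
            ∘ₗ conjHom b (divLin T ((g.eta : ℂ)⁻¹) (prodCfg U g.eta A))) Qs' a Q' * GExt = 1 ∧
      GExt *
      deltaA (conj b (lapDDLetter T ((g.eta : ℂ)⁻¹) (prodCfg U g.eta A)))
          (conj b (dPrimeLetter T (prodCfg U g.eta A) g.eta))
          (conjHom b (gradLin T ((g.eta : ℂ)⁻¹) (prodCfg U g.eta A)) ∘ₗ (1 - ((Gp ∘ₗ Qcs ∘ₗ Linv ∘ₗ Qc ∘ₗ Gp) + (B9Eq360Vprime.pPrime Gp (gPrimeExtEnd Gp (conj b (vPrimeConc T U g.eta A blk kQ kF sQ sF cfun) * Gp)) (Qcs ∘ₗ secRes rep) (Qcs' ∘ₗ secRes rep) (secConj rep Linv) (secConj rep Tinv) (secExt rep ∘ₗ Qc) (secExt rep ∘ₗ Qc'))))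
            ∘ₗ conjHom b (divLin T ((g.eta : ℂ)⁻¹) (prodCfg U g.eta A))) Qs' a Q' = 1 ∧
      -- (vii) NEW: the `L²` members (3.46)₁,₂,₃,₅ of Theorem 3.3 for THIS `G(U′U)`
      (∀ (y y' : g.Site) (hf μ : (κ × S) × ι → ℝ) (Hh : ℝ), 0 ≤ Hh → (∀ x, |hf x| ≤ Hh) → (∀ x, blk x.1.2 ≠ y → hf x = 0) →
        (∀ x, blk x.1.2 ≠ y' → μ x = 0) →
        Real.sqrt (∑ x, (hf x * GExt μ x) ^ 2) ≤ B * Hh * g.len y ^ 2 * Real.exp (-(1 / 20 * δ₀ * g.dist y y')) * Real.sqrt (∑ x, μ x ^ 2) ∧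
        (∀ k : κ ⊕ κ, Real.sqrt (∑ x, (hf x * ((conj b (diffLetter (bT T) (bU U) ((g.eta : ℂ)⁻¹) k)) * GExt) μ x) ^ 2) ≤ B * Hh * g.len y * Real.exp (-(1 / 20 * δ₀ * g.dist y y')) * Real.sqrt (∑ x, μ x ^ 2)) ∧
        (∀ l : κ ⊕ κ, Real.sqrt (∑ x, (hf x * (GExt * (conj b (diffLetter (bT T) (bU U) ((g.eta : ℂ)⁻¹) l))) μ x) ^ 2) ≤ B * Hh * g.len y * Real.exp (-(1 / 20 * δ₀ * g.dist y y')) * Real.sqrt (∑ x, μ x ^ 2)) ∧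
        (∀ k l : κ ⊕ κ, Real.sqrt (∑ x, (hf x * ((conj b (diffLetter (bT T) (bU U) ((g.eta : ℂ)⁻¹) k)) * GExt * (conj b (diffLetter (bT T) (bU U) ((g.eta : ℂ)⁻¹) l))) μ x) ^ 2) ≤ B * Hh * Real.exp (-(1 / 20 * δ₀ * g.dist y y')) * Real.sqrt (∑ x, μ x ^ 2))) := by
  classical
  -- the scale-transfer constants of the chain, READ FROM THE GIVEN FUNCTION `Λvf` (lattice-free)
  have hΛ1 : 1 ≤ Λvf (1 / 20) := hΛvf _ (by norm_num)
  obtain ⟨a₁, ha₁, B', hB', H28⟩ := thm34_all_uniform b κ d δ₀ B₀ κQ BG B₁ cF Cq a₀ C₀ d₀ M₂ κQb cFb abar Λf hB₀ hκQ hBG hB₁ hcF hCq ha₀ hC₀ hM₂ hδ₀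
    hκQb hcFb habar hΛf hrepr
  refine ⟨a₁, ha₁, cv * (Λvf (1 / 20)) * B', mul_nonneg (mul_nonneg hcv (zero_le_one.trans hΛ1)) hB', ?_⟩
  -- NOW the lattice, the background, the data, the Theorems-for-`U` inputs (block and kernel members); then `α₁`, `A` and the `A`-letters
  intro S _ _ T U g _ _ _ Rr H blk kQ sQ cfun w hdnn htri hrefl hsym hlen hlenη hη hL h261 hST hT hU1 h35 hd₀B hd₀F hd₀FB hd₀st hd₀loc hd₀0 hw hcard
    hkQ hsQ hcfun Gp h342_1 h342_2 h342_3 Δp hΔpGp hGpΔp rep hrep Qc Qcs Linv hQc hQcs hLinv h348 G Qs Q a hQb hQsb ha324 hΔG hGΔ hG hDG hGD v hv c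
    hc hGk hDGk hGDk hDGDk hvol hSTv α₁ hα₁0 hα₁1 A kF sF hkF hsF h337B h337F h337B' h337Bτ h337FB hA hAτB hAτF hAFB hAst hAloc hdAst Qc' Fc Qcs'
    Fcs h357 h357s hFc hFcs P₂ Qs' Q' F₂ F₂s h380 h380s hP₂def hF₂ hF₂s
  replace H28 := H28 T U blk kQ sQ cfun w hdnn htri hrefl hsym hlen hlenη hη hL h261 hST hT hU1 h35 hd₀B hd₀F hd₀FB hd₀st hd₀loc hd₀0 hw hcard hkQ
    hsQ hcfun h342_1 h342_2 h342_3 hΔpGp hGpΔp rep hrep hQc hQcs hLinv h348 hQb hQsb ha324 hΔG hGΔ hG hDG hGD hv hc hGk hDGk hGDk hDGDk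
  have hTv := hSTv (1 / 20) (by norm_num)
  obtain ⟨-, -, -, -, Tinv, GExt, e1, e2, -, -, -, -, -, -, -, -, -, e3, e4, -, -, K1, K2, K3, K4⟩ := H28 α₁ hα₁0 hα₁1 A kF sF hkF
    hsF h337B h337F h337B' h337Bτ h337FB hA hAτB hAτF hAFB hAst hAloc hdAst h357 h357s hFc hFcs h380 h380s hP₂def hF₂ hF₂s
  have hρ' : 1 / 20 * δ₀ + 1 / 20 * δ₀ ≤ 1 / 10 * δ₀ := by linarith only [hδ₀]
  have hw2 : ∀ a : g.Site, 0 ≤ g.len a ^ 2 := fun a => sq_nonneg _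
  have hw1 : ∀ a : g.Site, 0 ≤ g.len a := fun a => (hlen a).le
  have hw0 : ∀ _a : g.Site, (0 : ℝ) ≤ 1 := fun _ => zero_le_one
  refine ⟨Tinv, GExt, e1, e2, e3, e4, ?_⟩
  intro y y' hf μ Hh hHh hh hh0 hμ0
  refine ⟨?_, ?_, ?_, ?_⟩
  · simpa only using l2_block_of_kernelBound_transfer (R := Rr) (H := H) (fun q : (κ × S) × ι => blk q.1.2) hv hc hvol hB' hρ' hdnn hTv
      (w := fun a => g.len a ^ 2) hw2 K1 y y' hf μ Hh hHh hh hh0 hμ0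
  · intro k
    simpa only using l2_block_of_kernelBound_transfer (R := Rr) (H := H) (fun q : (κ × S) × ι => blk q.1.2) hv hc hvol hB' hρ' hdnn hTv
      (w := fun a => g.len a) hw1 (K2 k) y y' hf μ Hh hHh hh hh0 hμ0
  · intro l
    simpa only using l2_block_of_kernelBound_transfer (R := Rr) (H := H) (fun q : (κ × S) × ι => blk q.1.2) hv hc hvol hB' hρ' hdnn hTv
      (w := fun a => g.len a) hw1 (K3 l) y y' hf μ Hh hHh hh hh0 hμ0
  · intro k l
    have K4' := hasKernelBound_mono (g := toB6 g Rr H) (fun q : (κ × S) × ι => blk q.1.2) hv (K4 k l)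
      (K' := fun a a' => B' * (1 : ℝ) * Real.exp (-(1 / 10 * δ₀ * g.dist a a'))) fun a a' => le_of_eq (by ring)
    simpa only [mul_one] using l2_block_of_kernelBound_transfer (R := Rr) (H := H) (fun q : (κ × S) × ι => blk q.1.2) hv hc hvol hB' hρ' hdnn hTv
      (w := fun _ => (1 : ℝ)) hw0 K4' y y' hf μ Hh hHh hh hh0 hμ0

end L2U2

end Literature.MathematicalPhysics.QuantumFieldTheory.Balaban1983to89.B9Ineq346L2Uniform

end
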